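import Summits.QuantumFields.YangMills.Theorems.BalabanLadderIRTypAlgebra
import HarnessLib

/-!
# `IR` — the MIXED torus upgrade: one torus-level factor ∩ sup-`ζ`-rare factors ⇒ clause (iii_T) with added budgets

Spine route `BalabanLadder`, crux `IR` (stmt-QuantumFields-19354), registered line «af-pincer-T» (skeleton
0308f95ca6f6a115), clause **(iii_T)** of `TypShellCond` (torus anchor).  Count-neutral helper
(`--supports stmt-QuantumFields-19354 --as helper`); no stub claimed, no skeleton touched.

The card's working class is an INTERSECTION `Typ⋆ = Typ_bs ∩ Typ_hol [∩ …]` whose factors get their rarity from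
DIFFERENT suppliers: the ball-sparse small-field factor `Typ_bs` has clause (iii_T) at TORUS level only (odd-torus
chessboard, `OddTorusChessboard.torusAnchor_typBallSparse`; its kernel-level small-threshold rarity is the LDP debt),
while bulk factors come with single-cell sup-`ζ` KERNEL rarity (`IRKernelLargeField`, `IRTypDilute`), for which the
torus upgrade `torusJointRarity_of_supCellRarity` and the budget algebra `torusJointRarity_biInter` apply.  Torus-level
budgets of two different factors do NOT add by logic alone.  This file proves that they DO add when all but one factor
are sup-`ζ`-rare:

* `measureReal_allAtypical_inter_torus_le_pow_mul` — the torus upgrade WITH A SPECTATOR: for a cell-local measurable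
  `Typ` with single-cell sup-`ζ` rarity `δ`, a finite set `F` of cells inside the fundamental domain of the torus of
  side `2S+1 ≥ 4b`, and any measurable event `B ⊆ LGConfig 4 G` decided by the links of the cells of a finite set
  `F₁` inside the domain and DISJOINT from `F`:
  `μ.real {V | (∀ c ∈ F, torusLift V ∉ Typ c) ∧ torusLift V ∈ B} ≤ δ ^ #F · μ.real {V | torusLift V ∈ B}`
  (induction on `F`, one far-factor torus DLR step per cell, the spectator `1_B` riding along with the far factor);
* **`torusJointRarity_inter`** — clause (iii_T) for `Typ₁ ∩ Typ₂` with budget `δ₁ + δ₂`, given clause (iii_T) for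
  `Typ₁` ALONE at torus level with budget `δ₁` (for every finite cell set inside the domain, e.g. the conclusion of
  `torusAnchor_typBallSparse`) and single-cell sup-`ζ` rarity `δ₂` for `Typ₂` (e.g. a finite intersection of bulk
  factors, budgets pre-added by `supCellRarity_biInter`): split the all-atypical event of `F` according to the set
  `F₁ ⊆ F` of cells failing `Typ₁`, bound each piece by `δ₂ ^ #(F \ F₁) · δ₁ ^ #F₁` with the spectator lemma, and
  re-sum with the binomial identity `Finset.sum_pow_mul_eq_add_pow`.

Everything here is proved (no `sorry`, no new axioms).  HONEST FRAMING: soft torus-DLR bookkeeping about how the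
(iii_T) budgets of heterogeneous `Typ` factors combine; the factors' rarity estimates, (i_T), (ii_T) and the bridge
`TypCriterion` carry the weight of the line; the conditional chain (Track A) is untouched; not a gap, not Clay.
Refs: Georgii 2011 Thm. 4.17, (4.18); Friedli–Velenik 2017 Lemma 6.7.
-/

set_option autoImplicit false

noncomputable section

open MeasureTheory
open scoped ENNReal
open Literature.Probability.LatticeModels
open Literature.MathematicalPhysics.QuantumLattice
open Literature.MathematicalPhysics.QuantumFieldTheory (GaugeConfig wilsonMeasure isProbabilityMeasure_wilsonMeasure
  measurable_torusLift)
open Summit.QuantumFields.YangMills.Cruxes.IR.Tempered (cellEdges regionEdges)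
open Summit.QuantumFields.YangMills.Theorems.FiniteSizeCriterion
  (integral_torusLift_mul_eq_integral_ymSpecification_mul_of_measurable)

namespace Summit.QuantumFields.YangMills.Theorems.IRRarityUpgrade

section YangMills

variable {G : Type} [Group G] [TopologicalSpace G] [IsTopologicalGroup G] [CompactSpace G]
  [MeasurableSpace G] [BorelSpace G] [SecondCountableTopology G]
  {N : ℕ} (ρ : G →* Matrix (Fin N) (Fin N) ℂ)

/-- **Torus upgrade with a spectator event.**  Under single-cell sup-`ζ` rarity `δ` of a cell-local measurable `Typ`,
for cells `F` inside the fundamental domain of the torus of side `2S+1 ≥ 4b` (`b ≥ 1`) and a measurable event `B`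
decided by the links of the cells of `F₁` (inside the domain, disjoint from `F`):
`μ.real {V | (∀ c ∈ F, torusLift V ∉ Typ c) ∧ torusLift V ∈ B} ≤ δ ^ #F · μ.real {V | torusLift V ∈ B}`. -/
theorem measureReal_allAtypical_inter_torus_le_pow_mul (hρ : Continuous ρ) (β : ℝ) {b : ℕ} (hb : 1 ≤ b)
    {w : Fin 4 → ℤ → ℤ}
    (hw : ∀ i j, w i j + ((b : ℕ) : ℤ) ≤ w i (j + 1) ∧ w i (j + 1) ≤ w i j + 2 * ((b : ℕ) : ℤ))
    {Typ : (Fin 4 → ℤ) → Set (LGConfig 4 G)} (hTm : ∀ c, MeasurableSet (Typ c))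
    (hTd : ∀ c, DependsOn (fun σ : LGConfig 4 G => σ ∈ Typ c) ↑(cellEdges w c)) {δ : ℝ} (hδ : 0 ≤ δ)
    (h1 : ∀ (c : Fin 4 → ℤ) (ζ : LGConfig 4 G),
      (ymSpecification ρ β (regionEdges w {c}) ζ) (Typ c)ᶜ ≤ ENNReal.ofReal δ)
    {S : ℕ} (hS : 4 * b ≤ 2 * S + 1) {B : Set (LGConfig 4 G)} (hBm : MeasurableSet B)
    (F₁ : Finset (Fin 4 → ℤ)) (hBd : DependsOn (fun σ : LGConfig 4 G => σ ∈ B) ↑(F₁.biUnion (cellEdges w)))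
    (hF₁ : ∀ c ∈ F₁, ∀ i, -(S : ℤ) ≤ w i (c i) ∧ w i (c i + 1) ≤ (S : ℤ) + 1)
    (F : Finset (Fin 4 → ℤ)) (hF : ∀ c ∈ F, ∀ i, -(S : ℤ) ≤ w i (c i) ∧ w i (c i + 1) ≤ (S : ℤ) + 1)
    (hFF₁ : Disjoint F F₁) :
    (wilsonMeasure (d := 4) (L := 2 * S + 1) ρ β).real
        {V : GaugeConfig 4 (2 * S + 1) G | (∀ c ∈ F, torusLift (2 * S + 1) V ∉ Typ c) ∧
          torusLift (2 * S + 1) V ∈ B} ≤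
      δ ^ F.card * (wilsonMeasure (d := 4) (L := 2 * S + 1) ρ β).real
        {V : GaugeConfig 4 (2 * S + 1) G | torusLift (2 * S + 1) V ∈ B} := by
  classical
  set L : ℕ := 2 * S + 1 with hL
  set μ : Measure (GaugeConfig 4 L G) := wilsonMeasure (d := 4) (L := L) ρ β with hμ
  haveI : IsProbabilityMeasure μ := isProbabilityMeasure_wilsonMeasure (d := 4) (L := L) ρ hρ β
  -- the all-atypical-and-`B` events on `ℤ⁴`
  let E : Finset (Fin 4 → ℤ) → Set (LGConfig 4 G) := fun F => {σ | (∀ c ∈ F, σ ∉ Typ c) ∧ σ ∈ B}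
  have hEeq : ∀ F, E F = {σ : LGConfig 4 G | ∀ c ∈ F, σ ∉ Typ c} ∩ B := fun F => rfl
  have hEm : ∀ F, MeasurableSet (E F) := fun F => (measurableSet_allAtypical hTm F).inter hBm
  have hEd : ∀ F : Finset (Fin 4 → ℤ),
      DependsOn (fun σ : LGConfig 4 G => σ ∈ E F) ↑((F ∪ F₁).biUnion (cellEdges w)) := by
    intro F
    rw [hEeq]
    refine dependsOn_mem_inter ?_ ?_
    · exact (dependsOn_allAtypical (cellEdges w) hTd F).mono (by
        intro e he
        rw [Finset.mem_coe] at he ⊢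
        exact Finset.biUnion_subset_biUnion_of_subset_left _ Finset.subset_union_left he)
    · exact hBd.mono (by
        intro e he
        rw [Finset.mem_coe] at he ⊢
        exact Finset.biUnion_subset_biUnion_of_subset_left _ Finset.subset_union_right he)
  have hETm : ∀ F : Finset (Fin 4 → ℤ),
      MeasurableSet {V : GaugeConfig 4 L G | (∀ c ∈ F, torusLift L V ∉ Typ c) ∧ torusLift L V ∈ B} := fun F =>
    (hEm F).preimage (measurable_torusLift L)
  have hBTm : MeasurableSet {V : GaugeConfig 4 L G | torusLift L V ∈ B} := hBm.preimage (measurable_torusLift L)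
  -- single-cell rarity in `measureReal` form
  have h1' : ∀ (c : Fin 4 → ℤ) (ζ : LGConfig 4 G), (ymSpecification ρ β (cellEdges w c) ζ).real (Typ c)ᶜ ≤ δ :=
    fun c ζ => ENNReal.toReal_le_of_le_ofReal hδ (by rw [← regionEdges_singleton w c]; exact h1 c ζ)
  -- induction on `F`
  induction F using Finset.induction_on with
  | empty => simp
  | @insert c₀ F₀ hc₀ ih =>
    have hF₀ : ∀ c ∈ F₀, ∀ i, -(S : ℤ) ≤ w i (c i) ∧ w i (c i + 1) ≤ (S : ℤ) + 1 := fun c hc =>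
      hF c (Finset.mem_insert_of_mem hc)
    have hc₀in : ∀ i, -(S : ℤ) ≤ w i (c₀ i) ∧ w i (c₀ i + 1) ≤ (S : ℤ) + 1 := hF c₀ (Finset.mem_insert_self c₀ F₀)
    have hF₀F₁ : Disjoint F₀ F₁ := Finset.disjoint_of_subset_left (Finset.subset_insert _ _) hFF₁
    have hc₀F₁ : c₀ ∉ F₁ := Finset.disjoint_left.1 hFF₁ (Finset.mem_insert_self c₀ F₀)
    have ih' := ih hF₀ hF₀F₁
    rw [Finset.card_insert_of_notMem hc₀, pow_succ', mul_assoc]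
    -- the near observable and the far factor (the spectator rides along with the far factor)
    set Λ : Finset (ZdEdge 4) := cellEdges w c₀ with hΛ
    set f : LGConfig 4 G → ℝ := ((Typ c₀)ᶜ).indicator 1 with hf
    set H : GaugeConfig 4 L G → ℝ := fun V => (E F₀).indicator 1 (torusLift L V) with hH
    have hfm : Measurable f := measurable_one.indicator (hTm c₀).compl
    have hfC : ∀ U, |f U| ≤ 1 := fun U => by
      by_cases hU : U ∈ (Typ c₀)ᶜ <;> simp [hf, hU]
    have hfS : IsCylinder f Λ := by
      intro U U' hUU'
      have h := hTd c₀ hUU'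
      simp only [hf, Set.indicator_apply, Set.mem_compl_iff, eq_iff_iff, Pi.one_apply] at h ⊢
      simp only [h]
    have hHm : Measurable H := (measurable_one.indicator (hEm F₀)).comp (measurable_torusLift L)
    have hHD : ∀ V, |H V| ≤ 1 := fun V => by
      by_cases hV : torusLift L V ∈ E F₀ <;> simp [hH, hV]
    have hH0 : ∀ V, 0 ≤ H V := fun V => by
      by_cases hV : torusLift L V ∈ E F₀ <;> simp [hH, hV]
    have hHinv : ∀ W V, H ((Λ.image (torusEdge L)).piecewise W V) = H V := by
      intro W V
      simp only [hH]
      refine apply_torusLift_piecewise_eq (T := (F₀ ∪ F₁).biUnion (cellEdges w))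
        (g := (E F₀).indicator (1 : LGConfig 4 G → ℝ)) ?_ ?_ W V
      · intro U U' hUU'
        have h : (U ∈ E F₀) = (U' ∈ E F₀) := hEd F₀ hUU'
        by_cases hU : U ∈ E F₀
        · have hU' : U' ∈ E F₀ := h ▸ hU
          rw [Set.indicator_of_mem hU, Set.indicator_of_mem hU', Pi.one_apply, Pi.one_apply]
        · have hU' : U' ∉ E F₀ := fun h' => hU (h.symm ▸ h')
          rw [Set.indicator_of_notMem hU, Set.indicator_of_notMem hU']
      · intro e he e' he'
        obtain ⟨c, hc, hec⟩ := Finset.mem_biUnion.1 he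
        rcases Finset.mem_union.1 hc with hc | hc
        · have hne : c ≠ c₀ := fun h => hc₀ (h ▸ hc)
          exact torusEdge_ne_of_mem_cellEdges hw hne (hF₀ c hc) hc₀in hec he'
        · have hne : c ≠ c₀ := fun h => hc₀F₁ (h ▸ hc)
          exact torusEdge_ne_of_mem_cellEdges hw hne (hF₁ c hc) hc₀in hec he'
    -- the torus DLR identity with the far factor `H`
    have hdlr := integral_torusLift_mul_eq_integral_ymSpecification_mul_of_measurable ρ hρ β Λ hfm hfC hfS
      (L := L) (injOn_proj_cell_collar hw hb hS c₀) hHm hHD hHinv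
    -- left-hand side: the event of `insert c₀ F₀`
    have hlhs : ∫ V, f (torusLift L V) * H V ∂μ =
        μ.real {V : GaugeConfig 4 L G | (∀ c ∈ insert c₀ F₀, torusLift L V ∉ Typ c) ∧ torusLift L V ∈ B} := by
      rw [← integral_indicator_one (hETm _)]
      refine integral_congr_ae (Filter.Eventually.of_forall fun V => ?_)
      simp only [hf, hH, Set.indicator_apply, Set.mem_compl_iff, Set.mem_setOf_eq, Finset.forall_mem_insert,
        Pi.one_apply, mul_ite, mul_one, mul_zero]
      by_cases h0 : torusLift L V ∈ Typ c₀ <;>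
        by_cases h2 : (∀ c ∈ F₀, torusLift L V ∉ Typ c) ∧ torusLift L V ∈ B <;> simp [h0, h2, E]
    -- right-hand side: the kernel mean is at most `δ`
    have hrhs : ∫ V, (∫ U, f U ∂(ymSpecification ρ β Λ (torusLift L V))) * H V ∂μ ≤
        ∫ V, δ * H V ∂μ := by
      refine integral_mono_of_nonneg (Filter.Eventually.of_forall fun V => ?_) ?_
        (Filter.Eventually.of_forall fun V => ?_)
      · exact mul_nonneg (integral_nonneg fun U => Set.indicator_nonneg (fun _ _ => zero_le_one) U) (hH0 V)
      · exact (Literature.MathematicalPhysics.QuantumLattice.integrable_of_abs_le hHm hHD).const_mul δ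
      · have hker : ∫ U, f U ∂(ymSpecification ρ β Λ (torusLift L V)) ≤ δ := by
          rw [hf, integral_indicator_one (hTm c₀).compl]
          exact h1' c₀ (torusLift L V)
        exact mul_le_mul_of_nonneg_right hker (hH0 V)
    have hδH : ∫ V, δ * H V ∂μ =
        δ * μ.real {V : GaugeConfig 4 L G | (∀ c ∈ F₀, torusLift L V ∉ Typ c) ∧ torusLift L V ∈ B} := by
      rw [integral_const_mul, hH]
      congr 1
      rw [← integral_indicator_one (hETm F₀)]
      rfl
    calc μ.real {V : GaugeConfig 4 L G | (∀ c ∈ insert c₀ F₀, torusLift L V ∉ Typ c) ∧ torusLift L V ∈ B}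
        = ∫ V, f (torusLift L V) * H V ∂μ := hlhs.symm
      _ = ∫ V, (∫ U, f U ∂(ymSpecification ρ β Λ (torusLift L V))) * H V ∂μ := hdlr
      _ ≤ ∫ V, δ * H V ∂μ := hrhs
      _ = δ * μ.real {V : GaugeConfig 4 L G | (∀ c ∈ F₀, torusLift L V ∉ Typ c) ∧ torusLift L V ∈ B} := hδH
      _ ≤ δ * (δ ^ F₀.card * μ.real {V : GaugeConfig 4 L G | torusLift L V ∈ B}) :=
          mul_le_mul_of_nonneg_left ih' hδ

/-- **The mixed torus upgrade — clause (iii_T) of `TypShellCond` for `Typ₁ ∩ Typ₂` with budget `δ₁ + δ₂`.**  `Typ₁`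
is a cell-local measurable factor with clause (iii_T) at TORUS level (budget `δ₁`, every finite cell set inside the
fundamental domain — e.g. `OddTorusChessboard.torusAnchor_typBallSparse`), `Typ₂` a cell-local measurable factor with
single-cell sup-`ζ` KERNEL rarity `δ₂` (e.g. a finite intersection of bulk factors, `supCellRarity_biInter`).  Then on
every odd torus `2S+1 ≥ 4b` (`b ≥ 1`) and for every finite non-empty `F` inside `[-S, S]⁴`:
`μ_{2S+1,β} {V | ∀ c ∈ F, torusLift V ∉ Typ₁ c ∩ Typ₂ c} ≤ ofReal ((δ₁ + δ₂) ^ #F)`. -/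
theorem torusJointRarity_inter (hρ : Continuous ρ) (β : ℝ) {b : ℕ} (hb : 1 ≤ b) {w : Fin 4 → ℤ → ℤ}
    (hw : ∀ i j, w i j + ((b : ℕ) : ℤ) ≤ w i (j + 1) ∧ w i (j + 1) ≤ w i j + 2 * ((b : ℕ) : ℤ))
    {Typ₁ Typ₂ : (Fin 4 → ℤ) → Set (LGConfig 4 G)}
    (hTm₁ : ∀ c, MeasurableSet (Typ₁ c)) (hTd₁ : ∀ c, DependsOn (fun σ : LGConfig 4 G => σ ∈ Typ₁ c) ↑(cellEdges w c))
    (hTm₂ : ∀ c, MeasurableSet (Typ₂ c)) (hTd₂ : ∀ c, DependsOn (fun σ : LGConfig 4 G => σ ∈ Typ₂ c) ↑(cellEdges w c))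
    {δ₁ δ₂ : ℝ} (hδ₁ : 0 ≤ δ₁) (hδ₂ : 0 ≤ δ₂)
    (h₁ : ∀ S : ℕ, 4 * b ≤ 2 * S + 1 → ∀ F : Finset (Fin 4 → ℤ),
      (∀ c ∈ F, ∀ i, -(S : ℤ) ≤ w i (c i) ∧ w i (c i + 1) ≤ (S : ℤ) + 1) →
        (wilsonMeasure (d := 4) (L := 2 * S + 1) ρ β)
            {V : GaugeConfig 4 (2 * S + 1) G | ∀ c ∈ F, torusLift (2 * S + 1) V ∉ Typ₁ c} ≤
          ENNReal.ofReal (δ₁ ^ F.card))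
    (h₂ : ∀ (c : Fin 4 → ℤ) (ζ : LGConfig 4 G),
      (ymSpecification ρ β (regionEdges w {c}) ζ) (Typ₂ c)ᶜ ≤ ENNReal.ofReal δ₂) :
    ∀ S : ℕ, 4 * b ≤ 2 * S + 1 → ∀ F : Finset (Fin 4 → ℤ), F.Nonempty →
      (∀ c ∈ F, ∀ i, -(S : ℤ) ≤ w i (c i) ∧ w i (c i + 1) ≤ (S : ℤ) + 1) →
        (wilsonMeasure (d := 4) (L := 2 * S + 1) ρ β)
            {V : GaugeConfig 4 (2 * S + 1) G | ∀ c ∈ F, torusLift (2 * S + 1) V ∉ Typ₁ c ∩ Typ₂ c} ≤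
          ENNReal.ofReal ((δ₁ + δ₂) ^ F.card) := by
  classical
  intro S hS F _ hF
  set L : ℕ := 2 * S + 1 with hL
  set μ : Measure (GaugeConfig 4 L G) := wilsonMeasure (d := 4) (L := L) ρ β with hμ
  haveI : IsProbabilityMeasure μ := isProbabilityMeasure_wilsonMeasure (d := 4) (L := L) ρ hρ β
  -- the pieces of the splitting according to the set `F₁ ⊆ F` of cells failing `Typ₁`
  let P : Finset (Fin 4 → ℤ) → Set (GaugeConfig 4 L G) := fun F₁ =>
    {V | (∀ c ∈ F \ F₁, torusLift L V ∉ Typ₂ c) ∧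
      torusLift L V ∈ {σ : LGConfig 4 G | ∀ c ∈ F₁, σ ∉ Typ₁ c}}
  have hcover : {V : GaugeConfig 4 L G | ∀ c ∈ F, torusLift L V ∉ Typ₁ c ∩ Typ₂ c} ⊆
      ⋃ F₁ ∈ F.powerset, P F₁ := by
    intro V hV
    simp only [Set.mem_setOf_eq, Set.mem_inter_iff, not_and_or] at hV
    refine Set.mem_iUnion₂.2 ⟨F.filter fun c => torusLift L V ∉ Typ₁ c,
      Finset.mem_powerset.2 (Finset.filter_subset _ _), ?_, ?_⟩
    · intro c hc
      obtain ⟨hcF, hc1⟩ := Finset.mem_sdiff.1 hc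
      have hc1' : torusLift L V ∈ Typ₁ c := by
        by_contra h
        exact hc1 (Finset.mem_filter.2 ⟨hcF, h⟩)
      rcases hV c hcF with h | h
      · exact absurd hc1' h
      · exact h
    · intro c hc
      exact (Finset.mem_filter.1 hc).2
  -- each piece: spectator lemma (cells `F \ F₁` resampled, `B` = all of `F₁` failing `Typ₁`), then `h₁` on `F₁`
  have hpiece : ∀ F₁ ∈ F.powerset, μ (P F₁) ≤ ENNReal.ofReal (δ₂ ^ (F \ F₁).card * δ₁ ^ F₁.card) := by
    intro F₁ hF₁
    have hF₁F : F₁ ⊆ F := Finset.mem_powerset.1 hF₁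
    have hin₁ : ∀ c ∈ F₁, ∀ i, -(S : ℤ) ≤ w i (c i) ∧ w i (c i + 1) ≤ (S : ℤ) + 1 := fun c hc => hF c (hF₁F hc)
    have hin₂ : ∀ c ∈ F \ F₁, ∀ i, -(S : ℤ) ≤ w i (c i) ∧ w i (c i + 1) ≤ (S : ℤ) + 1 := fun c hc =>
      hF c (Finset.sdiff_subset hc)
    have hspec := measureReal_allAtypical_inter_torus_le_pow_mul ρ hρ β hb hw hTm₂ hTd₂ hδ₂ h₂ hS
      (measurableSet_allAtypical hTm₁ F₁) F₁ (dependsOn_allAtypical (cellEdges w) hTd₁ F₁) hin₁ (F \ F₁) hin₂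
      Finset.sdiff_disjoint
    have hB : μ.real {V : GaugeConfig 4 L G | torusLift L V ∈ {σ : LGConfig 4 G | ∀ c ∈ F₁, σ ∉ Typ₁ c}} ≤
        δ₁ ^ F₁.card := by
      have := h₁ S hS F₁ hin₁
      exact ENNReal.toReal_le_of_le_ofReal (pow_nonneg hδ₁ _) this
    rw [← ofReal_measureReal]
    refine ENNReal.ofReal_le_ofReal (hspec.trans ?_)
    exact mul_le_mul_of_nonneg_left hB (pow_nonneg hδ₂ _)
  -- re-sum with the binomial identity
  have hsum : ∑ F₁ ∈ F.powerset, δ₂ ^ (F \ F₁).card * δ₁ ^ F₁.card = (δ₁ + δ₂) ^ F.card := by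
    rw [← Finset.sum_pow_mul_eq_add_pow δ₁ δ₂ F]
    refine Finset.sum_congr rfl fun F₁ hF₁ => ?_
    rw [Finset.card_sdiff_of_subset (Finset.mem_powerset.1 hF₁), mul_comm]
  calc μ {V : GaugeConfig 4 L G | ∀ c ∈ F, torusLift L V ∉ Typ₁ c ∩ Typ₂ c}
      ≤ μ (⋃ F₁ ∈ F.powerset, P F₁) := measure_mono hcover
    _ ≤ ∑ F₁ ∈ F.powerset, μ (P F₁) := measure_biUnion_finset_le _ _
    _ ≤ ∑ F₁ ∈ F.powerset, ENNReal.ofReal (δ₂ ^ (F \ F₁).card * δ₁ ^ F₁.card) := Finset.sum_le_sum hpiece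
    _ = ENNReal.ofReal (∑ F₁ ∈ F.powerset, δ₂ ^ (F \ F₁).card * δ₁ ^ F₁.card) :=
        (ENNReal.ofReal_sum_of_nonneg fun F₁ _ => by positivity).symm
    _ = ENNReal.ofReal ((δ₁ + δ₂) ^ F.card) := by rw [hsum]

end YangMills

end Summit.QuantumFields.YangMills.Theorems.IRRarityUpgrade

end
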